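import Mathlib.Algebra.Star.Basic
import Mathlib.Algebra.Field.Basic
import Mathlib.Algebra.Group.Hom.Defs
import Mathlib.Algebra.Group.Basic
import Mathlib.Tactic.FieldSimp
import Mathlib.Tactic.LinearCombination
import Mathlib.Tactic.Ring
import HarnessLib

/-!
# The Gauss-period class is a character: the algebraic skeleton of THEOREM GP (WEIL-2 gen 38, TWOPRIMARY-G38, fact-free)

research route, not a corollary; conditional on HC_CM plus one named minimal statement.

Cell `pub-hodge-ring2-ab-*` (ALL ABELIAN VARIETIES), seat WEIL-2 gen 38, account
`run/shared/lean/pub/pub-hodge-ring2/pub-hodge-ring2-ab-weil-2/TWOPRIMARY-G38.md`.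

Informal setting (CIRCLE-G37 §3, TWOPRIMARY-G38 §1).  For `G = ℤ/f ⋊ H`, `h ∈ H` of order `m`, `σ = σ_h` acting on
`L = ℚ(ζ_f)` with fixed field `L_h`, the Gauss-period formula expresses the Weil discriminant class of the `τ`-piece of the
three-point datum `D₃(h; a, c)` through ONE arithmetic quantity, the norm `N_{L_h/K}(π π̄)` of a RESOLVENT `π`:
an element with `σ(π) = u · π` for a root of unity `u` (`u = μ⁻¹` in the account's convention `π/σ(π) = μ`).
THEOREM GP says that `μ ↦ [N_{L_h/K}(π_μ π̄_μ)] ∈ ℚ_{>0}^×/Nm K^×` is a HOMOMORPHISM on the norm-one roots of unity, trivial on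
coboundaries `σ(ρ)/ρ`; since the target has exponent two it kills every class of odd order, so only the 2-power roots of
unity matter, and for `μ = −1` the resolvent can be taken REAL, `π π̄ = π²`.  This file proves the ring-theoretic identities
behind these statements, over arbitrary commutative rings / fields with an endomorphism `σ` and an involution `star`
commuting with it: (1) resolvents multiply (eigenvalues multiply); (2) twisting a resolvent by a unit `ρ` changes the
eigenvalue by the coboundary `σ(ρ)/ρ`; (3) the norm element `π π̄` is `σ`-fixed when `u ū = 1`, multiplicative, and unchanged
by twists with `ρ ρ̄ = 1`; (4) a homomorphism into a group of exponent two kills every element of odd order (the 2-primary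
reduction); (5) the real resolvent for `u = −1`; (6) the resolvent `1 + ζ` for the inversion case `σ(ζ) = ζ⁻¹`, with norm
element `2 + ζ + ζ̄`.

0 sorry, no `def`, no named fact; `HC_CM` does not occur.
-/

namespace Summit.HodgeConjecture.Ring2AbelianAll.GaussPeriodCharacter

section resolvents

variable {R : Type*} [CommRing R]

/-- **Resolvents multiply.**  If `σ π₁ = u₁ π₁` and `σ π₂ = u₂ π₂` for a ring endomorphism `σ`, then `π₁ π₂` is a resolvent
for `u₁ u₂`.  (THEOREM GP (i): the Gauss-period class is multiplicative in the cocycle.)  [locator TWOPRIMARY-G38 §1 (i)]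
research route, not a corollary; conditional on HC_CM plus one named minimal statement. -/
theorem resolvent_mul (σ : R →+* R) (u₁ u₂ π₁ π₂ : R) (h₁ : σ π₁ = u₁ * π₁) (h₂ : σ π₂ = u₂ * π₂) :
    σ (π₁ * π₂) = (u₁ * u₂) * (π₁ * π₂) := by
  rw [map_mul, h₁, h₂]; ring

/-- **The norm element of a product is the product of the norm elements.**  [locator TWOPRIMARY-G38 §1 (i)]
research route, not a corollary; conditional on HC_CM plus one named minimal statement. -/
theorem normElement_mul [StarRing R] (π₁ π₂ : R) :
    (π₁ * π₂) * star (π₁ * π₂) = (π₁ * star π₁) * (π₂ * star π₂) := by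
  rw [star_mul]; ring

/-- **The norm element of a resolvent is `σ`-fixed** when the eigenvalue has absolute value one (`u ū = 1`) and `σ`
commutes with the involution: `σ(π π̄) = π π̄`, i.e. `π π̄` lies in the fixed ring `L_h` (indeed in `L_h⁺`).
[locator TWOPRIMARY-G38 §1 (i)]  research route, not a corollary; conditional on HC_CM plus one named minimal statement. -/
theorem normElement_fixed [StarRing R] (σ : R →+* R) (hσ : ∀ x, σ (star x) = star (σ x)) (u π : R)
    (hu : u * star u = 1) (hπ : σ π = u * π) : σ (π * star π) = π * star π := by
  rw [map_mul, hσ, hπ, star_mul]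
  linear_combination (π * star π) * hu

/-- **Twisting by a unit changes the eigenvalue by a coboundary.**  Over a field: if `σ π = u π` and `ρ ≠ 0` then `ρ π` is a
resolvent for `u · σ(ρ)/ρ`.  Hence the Gauss-period class only depends on the class of the cocycle modulo coboundaries
(THEOREM GP (i)).  [locator TWOPRIMARY-G38 §1 (i)]
research route, not a corollary; conditional on HC_CM plus one named minimal statement. -/
theorem resolvent_twist {F : Type*} [Field F] (σ : F →+* F) (u π ρ : F) (hρ : ρ ≠ 0) (hπ : σ π = u * π) :
    σ (ρ * π) = (u * (σ ρ / ρ)) * (ρ * π) := by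
  rw [map_mul, hπ]
  field_simp

/-- **Twisting by an element of absolute value one does not change the norm element**: `(ρπ)(ρπ)‾ = π π̄` when `ρ ρ̄ = 1`
(roots of unity `ρ`).  [locator TWOPRIMARY-G38 §1 (i)]
research route, not a corollary; conditional on HC_CM plus one named minimal statement. -/
theorem normElement_twist [StarRing R] (π ρ : R) (hρ : ρ * star ρ = 1) :
    (ρ * π) * star (ρ * π) = π * star π := by
  rw [star_mul]
  linear_combination (π * star π) * hρ

/-- **The real resolvent for the sign cocycle.**  If `σ π = −π` and `π` is real (`π̄ = π`), then the norm element is the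
square `π²`, and `π²` is `σ`-fixed: for `μ = −1` the Gauss-period class is the class of `N(π²)`, `π² = Δ⁺` a generator of the
quadratic layer `(L^{σ²})⁺ = L_h⁺(√Δ⁺)` — whence THEOREM GP (iv): `GP_h(−1) = [d_{(L^{h²})⁺}]`.  [locator TWOPRIMARY-G38 §1 (iv)]
research route, not a corollary; conditional on HC_CM plus one named minimal statement. -/
theorem real_resolvent_sign [StarRing R] (σ : R →+* R) (π : R) (hσ : σ π = -π) (hreal : star π = π) :
    π * star π = π ^ 2 ∧ σ (π ^ 2) = π ^ 2 := by
  refine ⟨by rw [hreal, sq], ?_⟩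
  rw [map_pow, hσ, neg_sq]

/-- **The resolvent of the inversion case.**  If `σ` inverts the unit `ζ` (`σ ζ = ζ⁻¹`, e.g. `h ≡ −1 (mod 2^k)` acting on
`ζ = ζ_{2^k}`), then `π = 1 + ζ` satisfies `σ π = ζ⁻¹ π`: it is a resolvent for the generator `ζ` of
`H¹(⟨σ⟩, μ_{2^k}) ≅ ℤ/2` (THEOREM GP (v)).  [locator TWOPRIMARY-G38 §1 (v)]
research route, not a corollary; conditional on HC_CM plus one named minimal statement. -/
theorem resolvent_inversion {F : Type*} [Field F] (σ : F →+* F) (ζ : F) (hζ : ζ ≠ 0) (hσ : σ ζ = ζ⁻¹) :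
    σ (1 + ζ) = ζ⁻¹ * (1 + ζ) := by
  rw [map_add, map_one, hσ]
  field_simp
  ring

/-- **Norm element of the inversion resolvent**: `(1 + ζ)(1 + ζ̄) = 2 + ζ + ζ̄` when `ζ ζ̄ = 1`; for `ζ = ζ_{2^k}` this is the
totally positive generator `2 + 2cos(2π/2^k)` of the prime of `ℚ(ζ_{2^k})⁺` above `2` (absolute norm `2`), whence
`GP_h(ζ_{2^k}) = [2]^{[L_h⁺ : ℚ(ζ_{2^k})⁺]}` in the inversion case.  [locator TWOPRIMARY-G38 §1 (v)]
research route, not a corollary; conditional on HC_CM plus one named minimal statement. -/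
theorem normElement_inversion [StarRing R] (ζ : R) (hζ : ζ * star ζ = 1) :
    (1 + ζ) * star (1 + ζ) = 2 + ζ + star ζ := by
  rw [star_add, star_one]
  linear_combination hζ

end resolvents

section twoprimary

/-- **The 2-primary reduction (THEOREM GP (ii)).**  A homomorphism from a commutative group into a group in which every
element squares to the identity (the norm class group `ℚ^×/Nm K^×`) kills every element of odd order: the Gauss-period
class of a norm-one root of unity only depends on its 2-power component.  [locator TWOPRIMARY-G38 §1 (ii)]
research route, not a corollary; conditional on HC_CM plus one named minimal statement. -/
theorem map_eq_one_of_pow_odd {A V : Type*} [CommGroup A] [Group V] (φ : A →* V) (hV : ∀ v : V, v * v = 1)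
    (a : A) (k : ℕ) (ha : a ^ (2 * k + 1) = 1) : φ a = 1 := by
  have hsq : a = a ^ (k + 1) * a ^ (k + 1) := by
    rw [← pow_add, show k + 1 + (k + 1) = 2 * k + 1 + 1 by ring, pow_succ, ha, one_mul]
  rw [hsq, map_mul]
  exact hV _

/-- **A character of a group of exponent two is determined on a cyclic 2-group by one value**: if `b = a ^ n` then
`φ b = φ a` for `n` odd and `φ b = 1` for `n` even (THEOREM GP (iii): `GP_h(μ) = g_h^{ε(μ)}`, `ε(μ) = 1` iff the 2-component
of `μ` has the maximal order `2^r`).  [locator TWOPRIMARY-G38 §1 (iii)]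
research route, not a corollary; conditional on HC_CM plus one named minimal statement. -/
theorem map_pow_exponent_two {A V : Type*} [CommGroup A] [CommGroup V] (φ : A →* V) (hV : ∀ v : V, v * v = 1)
    (a : A) (n : ℕ) : φ (a ^ n) = if n % 2 = 1 then φ a else 1 := by
  induction n with
  | zero => simp
  | succ n ih =>
    rw [pow_succ, map_mul, ih]
    rcases Nat.mod_two_eq_zero_or_one n with h | h
    · have h' : (n + 1) % 2 = 1 := by omega
      simp [h, h']
    · have h' : (n + 1) % 2 = 0 := by omega
      simp [h, h', hV]

end twoprimary

end Summit.HodgeConjecture.Ring2AbelianAll.GaussPeriodCharacter
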